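import Summits.BirchSwinnertonDyer.BirchSwinnertonDyer.Theorems.TwoAdicConverseFrobeniusParityTwoDivisionRoot
import Literature.FieldTheory.FiniteFields.QModulusPolynomial
import Mathlib.FieldTheory.SplittingField.Construction
import Mathlib.Algebra.CharP.Algebra
import HarnessLib

/-!
# Route `TwoAdicConverse` (rung S3), crux `OrdLambdaHalfAtTwo` (item 19556): a cubic with NO root over a finite field has a
# SQUARE discriminant — hence `(Δ/ℓ) = −1 ⇒ a_ℓ` is even

Cell `bsd-2adic`, seat `bsd-2adic-conv-1` (GEN 21). THEOREMS ONLY — no named fact, no definition, nothing conditional. Completes the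
parity dictionary of `TwoAdicConverseFrobeniusParityTwoDivisionRoot` (`a_ℓ` even ⟺ `ψ₂²` has a root mod `ℓ`) and
`TwoAdicConverseModFourTraceSquareDiscriminant` (`(Δ/ℓ) = 1 ⇒ a_ℓ` odd or `≡ ℓ + 1 (mod 4)`) on the OTHER square class:

* `isSquare_discr_of_forall_ne_zero` — **a cubic `P` over a finite field with no root in it has `IsSquare P.discr`**. Proof
  (Frobenius, no Galois theory): in the splitting field `K`, `P = a(X−x)(X−y)(X−z)` with `x, y, z` distinct (else `discr = 0`);
  `t ↦ t^q` is a ring map fixing exactly the image of `𝔽_q` (tree `QModulusPolynomial.pow_card_eq_self_iff`), permutes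
  `{x, y, z}` and fixes none of them (a fixed root would lie in `𝔽_q`), hence is a `3`-cycle, so it FIXES
  `δ = (x−y)(x−z)(y−z)`; thus `δ ∈ 𝔽_q` and `discr = (a²δ)²` (`Cubic.discr_eq_prod_three_roots`).
* `exists_root_psi_of_not_isSquare_Δ` / `two_dvd_natCard_point_of_not_isSquare_Δ` — for an elliptic curve over a finite field with
  `2 ≠ 0`: `Δ` NOT a square ⇒ `ψ₂²` has a root ⇒ `2 ∣ #V(𝔽)`;
* **`even_frobeniusTrace_of_not_isSquare_discr`** — for a globally minimal `W/ℚ` at an odd good `ℓ`: `(Δ/ℓ) = −1 ⇒ a_ℓ` even;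
  `isSquare_discr_of_odd_frobeniusTrace` — `a_ℓ` odd ⇒ `Δ` is a square mod `ℓ` (the classical «supersingular-free» parity fact: the
  primes with odd trace split in `ℚ(√Δ)`).

HONEST FRAMING: elementary; nothing about `λ` or BSD; items 19556 / 19218 stay OPEN; BSD is not proved by any of this. PARTITION (D-0054):
none — RANK axis (S3). References: J. H. Silverman, *AEC* (2009), III.2.3, V.2.3.1 [SilvermanAEC2009]; R. Lidl, H. Niederreiter,
*Finite Fields* (1996), Lemma 2.4 [LidlNiederreiter1996].
-/

set_option linter.dupNamespace false
set_option autoImplicit false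

noncomputable section

open scoped Classical
open Polynomial WeierstrassCurve Literature.NumberTheory.EllipticCurves

namespace Summit.BirchSwinnertonDyer.BirchSwinnertonDyer.Theorems.TwoAdicTwistConverse

/-! ## §1. A rootless cubic over a finite field has a square discriminant -/

section Cubic

variable {k : Type*} [Field k] [Fintype k]

/-- **A cubic with no root in a finite field `𝔽_q` has a square discriminant** (Frobenius acts on its three roots as a `3`-cycle, an
EVEN permutation, so it fixes `δ = (x−y)(x−z)(y−z)`, i.e. `δ ∈ 𝔽_q` and `discr = (a²δ)²`). [cite: LidlNiederreiter1996, Lemma 2.4] -/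
theorem isSquare_discr_of_forall_ne_zero (P : Cubic k) (ha : P.a ≠ 0)
    (hno : ∀ r : k, P.a * r ^ 3 + P.b * r ^ 2 + P.c * r + P.d ≠ 0) : IsSquare P.discr := by
  by_cases hD : P.discr = 0
  · exact ⟨0, by rw [hD, mul_zero]⟩
  -- the splitting field and the three distinct roots
  let K := P.toPoly.SplittingField
  let φ : k →+* K := algebraMap k K
  have hsplit : Splits (P.toPoly.map φ) := SplittingField.splits P.toPoly
  obtain ⟨x, y, z, h3⟩ := (Cubic.splits_iff_roots_eq_three ha).mp hsplit
  obtain ⟨hxy, hxz, hyz⟩ := (Cubic.discr_ne_zero_iff_roots_ne ha h3).mp hD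
  have hdisc := Cubic.discr_eq_prod_three_roots ha h3
  -- roots of the mapped cubic are exactly `x, y, z`
  have hφa : (Cubic.map φ P).a = φ P.a := rfl
  have h0 : (Cubic.map φ P).toPoly ≠ 0 := Cubic.ne_zero_of_a_ne_zero (by rw [hφa]; exact (map_ne_zero φ).mpr ha)
  have hroot : ∀ t : K, (φ P.a * t ^ 3 + φ P.b * t ^ 2 + φ P.c * t + φ P.d = 0) ↔ (t = x ∨ t = y ∨ t = z) := by
    intro t
    have h := Cubic.mem_roots_iff h0 t
    rw [h3] at h
    have h' : (φ P.a * t ^ 3 + φ P.b * t ^ 2 + φ P.c * t + φ P.d = 0) ↔ t ∈ ({x, y, z} : Multiset K) := h.symm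
    rw [h']
    simp [Multiset.mem_cons]
  -- Frobenius `t ↦ t^q`
  obtain ⟨p, hchar⟩ := CharP.exists k
  haveI : Fact p.Prime := ⟨CharP.char_is_prime k p⟩
  haveI : CharP K p := charP_of_injective_algebraMap φ.injective p
  have hFadd : ∀ s t : K, (s + t) ^ Fintype.card k = s ^ Fintype.card k + t ^ Fintype.card k := by
    intro s t
    simpa using Literature.RepresentationTheory.ClassicalInvariants.DicksonPolynomials.add_pow_card_pow
      (k := k) p s t 1
  have hFsub : ∀ s t : K, (s - t) ^ Fintype.card k = s ^ Fintype.card k - t ^ Fintype.card k := by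
    intro s t
    have h := hFadd (s - t) t
    rw [sub_add_cancel] at h
    linear_combination -h
  have hFinj : ∀ s t : K, s ^ Fintype.card k = t ^ Fintype.card k → s = t := by
    intro s t h
    have h' : (s - t) ^ Fintype.card k = 0 := by rw [hFsub, h, sub_self]
    exact sub_eq_zero.mp (pow_eq_zero_iff (Fintype.card_ne_zero) |>.mp h')
  have hFfix : ∀ c : k, (φ c) ^ Fintype.card k = φ c := fun c ↦ by rw [← map_pow, FiniteField.pow_card]
  -- Frobenius maps roots to roots and fixes none of them
  have hFroot : ∀ t : K, (t = x ∨ t = y ∨ t = z) →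
      (t ^ Fintype.card k = x ∨ t ^ Fintype.card k = y ∨ t ^ Fintype.card k = z) := by
    intro t ht
    rw [← hroot] at ht ⊢
    have h := congrArg (fun u : K ↦ u ^ Fintype.card k) ht
    simp only [zero_pow Fintype.card_ne_zero] at h
    rw [hFadd, hFadd, hFadd, mul_pow, mul_pow, mul_pow, hFfix, hFfix, hFfix, hFfix, ← pow_mul, ← pow_mul,
      mul_comm 3, mul_comm 2, pow_mul, pow_mul] at h
    exact h
  have hnofix : ∀ t : K, (t = x ∨ t = y ∨ t = z) → t ^ Fintype.card k ≠ t := by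
    intro t ht hfix
    obtain ⟨c, hc⟩ :=
      (Literature.FieldTheory.FiniteFields.QModulusPolynomial.pow_card_eq_self_iff (k := k) t).mp hfix
    apply hno c
    apply φ.injective
    rw [map_zero]
    have := (hroot t).mpr ht
    rw [← hc] at this
    simpa using this
  -- hence Frobenius is a 3-cycle on `{x, y, z}` and fixes `δ`
  set q := Fintype.card k with hq
  have hδ : ((x - y) * (x - z) * (y - z)) ^ q = (x - y) * (x - z) * (y - z) := by
    rw [mul_pow, mul_pow, hFsub, hFsub, hFsub]
    have hx' := hFroot x (Or.inl rfl)
    have hy' := hFroot y (Or.inr (Or.inl rfl))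
    have hz' := hFroot z (Or.inr (Or.inr rfl))
    have hxn := hnofix x (Or.inl rfl)
    have hyn := hnofix y (Or.inr (Or.inl rfl))
    have hzn := hnofix z (Or.inr (Or.inr rfl))
    rcases hx' with hxx | hxy' | hxz'
    · exact absurd hxx hxn
    · -- `x ↦ y`: then `y ↦ z`, `z ↦ x`
      rcases hy' with hyx | hyy | hyz'
      · -- `y ↦ x`: forces `z ↦ z`
        exfalso
        rcases hz' with hzx | hzy | hzz
        · exact hyz (hFinj y z (by rw [hyx, hzx]))
        · exact hxz (hFinj x z (by rw [hxy', hzy]))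
        · exact hzn hzz
      · exact absurd hyy hyn
      · rcases hz' with hzx | hzy | hzz
        · rw [hxy', hyz', hzx]; ring
        · exact absurd (hFinj x z (by rw [hxy', hzy])) hxz
        · exact absurd hzz hzn
    · -- `x ↦ z`: then `z ↦ y`, `y ↦ x`
      rcases hz' with hzx | hzy | hzz
      · -- `z ↦ x`: forces `y ↦ y`
        exfalso
        rcases hy' with hyx | hyy | hyz'
        · exact hyz (hFinj y z (by rw [hyx, hzx]))
        · exact hyn hyy
        · exact hxy (hFinj x y (by rw [hxz', hyz']))
      · rcases hy' with hyx | hyy | hyz'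
        · rw [hxz', hzy, hyx]; ring
        · exact absurd hyy hyn
        · exact absurd (hFinj x y (by rw [hxz', hyz'])) hxy
      · exact absurd hzz hzn
  obtain ⟨c, hc⟩ :=
    (Literature.FieldTheory.FiniteFields.QModulusPolynomial.pow_card_eq_self_iff (k := k) _).mp hδ
  have hc' : φ c = (x - y) * (x - z) * (y - z) := hc
  refine ⟨P.a * P.a * c, φ.injective ?_⟩
  rw [hdisc]
  simp only [map_mul]
  linear_combination (-(φ P.a * φ P.a) ^ 2 * (φ c + (x - y) * (x - z) * (y - z))) * hc'

end Cubic

/-! ## §2. Elliptic curves over a finite field: `Δ` a non-square forces a point of order `2` -/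

section Field

variable {F : Type*} [Field F] [Fintype F] (V : WeierstrassCurve F) [V.IsElliptic]

omit [V.IsElliptic] in
/-- **`Δ` not a square ⇒ `ψ₂²` has a root in `𝔽`** (`2 ≠ 0`): `ψ₂²` is the cubic `⟨4, b₂, 2b₄, b₆⟩` with discriminant `16Δ`
(`twoTorsionPolynomial_discr`); a rootless cubic would make `16Δ`, hence `Δ`, a square. [cite: SilvermanAEC2009, III.2.3] -/
theorem exists_root_psi_of_not_isSquare_Δ (h2 : (2 : F) ≠ 0) (hΔ : ¬ IsSquare V.Δ) :
    ∃ x : F, 4 * x ^ 3 + V.b₂ * x ^ 2 + 2 * V.b₄ * x + V.b₆ = 0 := by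
  by_contra hno
  push Not at hno
  have h4 : (4 : F) ≠ 0 := by rw [show (4 : F) = 2 * 2 by norm_num]; exact mul_ne_zero h2 h2
  have hsq := isSquare_discr_of_forall_ne_zero V.twoTorsionPolynomial (by simpa [twoTorsionPolynomial] using h4)
    (by simpa [twoTorsionPolynomial] using hno)
  rw [twoTorsionPolynomial_discr, show (16 : F) = 4 ^ 2 by norm_num] at hsq
  exact hΔ ((isSquare_sq_mul_iff h4 V.Δ).mp hsq)

/-- **`Δ` not a square ⇒ `2 ∣ #V(𝔽)`** (elliptic `V` over a finite field with `2 ≠ 0`). [cite: SilvermanAEC2009, III.2.3] -/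
theorem two_dvd_natCard_point_of_not_isSquare_Δ (h2 : (2 : F) ≠ 0) (hΔ : ¬ IsSquare V.Δ) : 2 ∣ Nat.card V.toAffine.Point :=
  (two_dvd_natCard_point_iff_exists_root V h2).mpr (exists_root_psi_of_not_isSquare_Δ V h2 hΔ)

end Field

/-! ## §3. Globally minimal curves over `ℚ`: `(Δ/ℓ) = −1 ⇒ a_ℓ` even -/

section Rat

variable (W : WeierstrassCurve ℚ) [W.IsElliptic] [W.IsGloballyMinimal] (ℓ : ℕ) [Fact ℓ.Prime]

omit [W.IsElliptic] in
/-- **`(Δ/ℓ) = −1 ⇒ 2 ∣ #W̃(𝔽_ℓ)`** at an odd good prime `ℓ`. [cite: SilvermanAEC2009, III.2.3 and VII.2] -/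
theorem two_dvd_reductionPointCount_of_not_isSquare_discr (hℓ : ℓ ≠ 2) (hgood : W.HasGoodReductionAtPrime ℓ)
    (hΔ : ¬ IsSquare ((minimalDiscriminantInt W : ZMod ℓ))) : 2 ∣ W.reductionPointCount ℓ := by
  have hΔℓ : ¬ (ℓ : ℤ) ∣ minimalDiscriminantInt W := not_dvd_minimalDiscriminantInt_of_hasGoodReductionAtPrime' W ℓ hgood
  haveI hE : (reductionModPrime W ℓ).IsElliptic := isElliptic_reductionModPrime W hΔℓ
  have h2F : (2 : ZMod ℓ) ≠ 0 := by
    intro h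
    have h' : ((2 : ℕ) : ZMod ℓ) = 0 := by exact_mod_cast h
    rw [ZMod.natCast_eq_zero_iff] at h'
    exact hℓ ((Nat.prime_dvd_prime_iff_eq Fact.out Nat.prime_two).mp h')
  have hΔV : ¬ IsSquare (reductionModPrime W ℓ).Δ := by
    simpa only [reductionModPrime, map_Δ, eq_intCast, minimalDiscriminantInt] using hΔ
  rw [reductionPointCount_eq_natCard_point]
  exact two_dvd_natCard_point_of_not_isSquare_Δ (reductionModPrime W ℓ) h2F hΔV

omit [W.IsElliptic] in
/-- **`(Δ/ℓ) = −1 ⇒ a_ℓ` is even** at an odd good prime `ℓ` (`a_ℓ = ℓ + 1 − #W̃(𝔽_ℓ)`). [cite: SilvermanAEC2009, V.2.3.1] -/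
theorem even_frobeniusTrace_of_not_isSquare_discr (hℓ : ℓ ≠ 2) (hgood : W.HasGoodReductionAtPrime ℓ)
    (hΔ : ¬ IsSquare ((minimalDiscriminantInt W : ZMod ℓ))) : Even (W.frobeniusTrace ℓ) := by
  have h2 := two_dvd_reductionPointCount_of_not_isSquare_discr W ℓ hℓ hgood hΔ
  obtain ⟨k, hk⟩ := (Fact.out : ℓ.Prime).odd_of_ne_two hℓ
  have hℓ' : (ℓ : ℤ) = 2 * k + 1 := by exact_mod_cast hk
  obtain ⟨m, hm⟩ := h2
  have hm' : (W.reductionPointCount ℓ : ℤ) = 2 * m := by exact_mod_cast hm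
  rw [WeierstrassCurve.frobeniusTrace, hℓ', hm']
  exact ⟨(k : ℤ) + 1 - m, by ring⟩

omit [W.IsElliptic] in
/-- **`a_ℓ` odd ⇒ `Δ` is a square mod `ℓ`** (odd good `ℓ`): the primes of odd trace split in `ℚ(√Δ)` (equivalently Frobenius is a
`3`-cycle on `E[2]`, an even permutation). [cite: SilvermanAEC2009, III.2.3 and V.2.3.1] -/
theorem isSquare_discr_of_odd_frobeniusTrace (hℓ : ℓ ≠ 2) (hgood : W.HasGoodReductionAtPrime ℓ)
    (hodd : Odd (W.frobeniusTrace ℓ)) : IsSquare ((minimalDiscriminantInt W : ZMod ℓ)) := by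
  by_contra hΔ
  exact (Int.not_even_iff_odd.mpr hodd) (even_frobeniusTrace_of_not_isSquare_discr W ℓ hℓ hgood hΔ)

omit [W.IsElliptic] in
/-- **Legendre form: `a_ℓ` odd ⇒ `(Δ/ℓ) = 1`** (odd good `ℓ`). [cite: SilvermanAEC2009, V.2.3.1] -/
theorem legendreSym_discr_eq_one_of_odd_frobeniusTrace (hℓ : ℓ ≠ 2) (hgood : W.HasGoodReductionAtPrime ℓ)
    (hodd : Odd (W.frobeniusTrace ℓ)) : legendreSym ℓ (minimalDiscriminantInt W) = 1 := by
  have hΔ0 : (minimalDiscriminantInt W : ZMod ℓ) ≠ 0 := by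
    rw [Ne, ZMod.intCast_zmod_eq_zero_iff_dvd]
    exact not_dvd_minimalDiscriminantInt_of_hasGoodReductionAtPrime' W ℓ hgood
  exact (legendreSym.eq_one_iff ℓ hΔ0).mpr (isSquare_discr_of_odd_frobeniusTrace W ℓ hℓ hgood hodd)

end Rat

end Summit.BirchSwinnertonDyer.BirchSwinnertonDyer.Theorems.TwoAdicTwistConverse

end
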